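import Literature.NumberTheory.LFunctions.SimpleZeros
import HarnessLib

/-!
# An unconditional Montgomery theorem for pair correlation (Baluyot–Goldston–Suriajaya–
# Turnage-Butterbaugh, Acta Arith. 214 (2024)): Theorem 1, Lemma 5, Theorems 2–3

LABEL (cell `landau-siegel`, sub-cell §C literature harvest, rung F-S3, row T-094 of
`lit/HARVEST.md`; tag **E*-ℓ**: the UNCONDITIONAL `[−1,1]`-support pair-correlation information
from which, on RH, Montgomery / Goldston–Gonek–Özlük–Snyder / Chirre–Gonçalves–de Laat /
Bui–Goldston–Milinovich–Montgomery extract positive proportions of small spacings — see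
`ZetaSpacingDensityRH.lean`). STATEMENT LAYER: four NAMED FACTS (D-0014; `def … : Prop`,
theorem-in-print, nothing asserted) — Theorem 1 (UNCONDITIONAL: `F(α)` is real, even, non-negative
and `F(α) = T^{−2α}(log T + O(1)) + α + O(1/√log T)` uniformly on `0 ≤ α ≤ 1`), Lemma 5 (the sum
over pairs of zeros against `r̂` for even `r` with `supp r ⊆ [−1,1]`), Theorem 2 (at least `61.7 %`
simple zeros under the thin-box hypothesis) and Theorem 3 (the same under a strong zero-density
hypothesis) — over the tree's zero vocabulary for zeros OFF the line (`zetaZeroBox`,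
`riemannZetaZeroOrder`, `zetaZeroCount`, `zetaZeroCountRe`, `simpleZeroCount` of `ZetaZeros.lean` /
`SimpleZeros.lean`), plus the DEFINITIONS of the paper's objects (`F(x,T)`, `F(α)`,
`w(u) = 4/(4 − u²)`, `r̂(z)` at complex `z`) and a little PROVED bookkeeping. **ERRATUM
(2026-08-27, REF-C ruling (α)):** the error term of Theorem 1 as printed in 2024 was RETRACTED by the
authors (arXiv:2501.14545 §2, "Montgomery Theorem (MT)"); `baluyotEtAl2024_theorem1` keeps its name and
meaning but is `@[deprecated]`, and the corrected statement is the fifth, CLAIM-tagged named fact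
`baluyotEtAl2025_montgomeryTheorem` over the dyadic window `T < γ,γ′ ≤ 2T` (`BGSTB2024.zerosIn`,
`BGSTB2024.pairSumDyadic`); see the docstrings of both. KERNEL STATUS (2026-08-27): the corrected
(MT) is PROVED for both windows — dyadic: `baluyotEtAl2025_montgomeryTheorem_holds`
(`UnconditionalPairCorrelationProofs.lean`); original window `0 < γ ≤ T`:
`BGSTB2024.pairSum_montgomeryTheorem` / `BGSTB2024.formFactor_montgomeryTheorem`
(`UnconditionalPairCorrelationTheorem1Proofs.lean`) — and Lemma 5 is DISCHARGED:
`baluyotEtAl2024_lemma5_holds` (`UnconditionalPairCorrelationLemma5Proofs.lean`); Theorems 2–3 are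
DISCHARGED through `AlpogeFurman2026_simple_critical_holds` (`CriticalLineTwoThirdsSimpleZerosConsequences.lean`).
Only the `@[deprecated]` `baluyotEtAl2024_theorem1` (the RETRACTED precision) remains — by design — unproved.

Why the row matters (lit/HARVEST.md T-094): the tree's pair-correlation files
(`MontgomeryPairCorrelation.lean`, `PairCorrelationSmallGaps.lean`, `ZetaSpacingDensityRH.lean`) are
written in the ORDINATE vocabulary, which presupposes RH to identify `ρ − ρ′` with `i(γ − γ′)`;
this paper's `F(x,T) = Σ x^{ρ−ρ′} w(ρ−ρ′)` is the RH-free object, and Theorem 1 is the RH-free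
form of Montgomery's theorem. What is still missing in print for an UNCONDITIONAL close-pair
count in the strip (Conrey–Iwaniec's admissible input, their §1 p. 3) is recorded in
`lit/HARVEST.md` OQ-062: a minorant/majorant pair for the complex-argument window count, and the
threshold `½` (the RH numbers are `0.60…`).

## What the source prints (held text `paper:arxiv-2306.04799`, corpus-tex chunks p0002–p0007,
read 2026-08-26)

S. A. C. Baluyot, D. A. Goldston, A. I. Suriajaya, C. L. Turnage-Butterbaugh, *An unconditional
Montgomery theorem for pair correlation of zeros of the Riemann zeta-function*, Acta Arith. 214
(2024) 357–376, doi:10.4064/aa230612-20-3 [BaluyotEtAl2024].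

§1 (p0003:L1–14): "Let `ρ = β + iγ` denote a nontrivial zero … define, for `x > 0` and `T ≥ 3`,
`F(x,T) := Σ_{ρ,ρ′: 0<γ,γ′≤T} x^{ρ−ρ′} w(ρ−ρ′)`, where `w(u) := 4/(4 − u²)` (1.2), where here and
throughout the paper, zeros are counted with multiplicity. Note that if RH holds then (1.2) agrees
with (1.1). … `F(α) := ((T/2π) log T)⁻¹ F(T^α,T)` (1.3)."

> **Theorem 1** (p0003:L16–22). The function `F(α)` is real, even, and nonnegative. Moreover, as
> `T → ∞`, we have `F(α) = T^{−2α}(log T + O(1)) + α + O(1/√log T)` (1.4) uniformly for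
> `0 ≤ α ≤ 1`.

> **Theorem 2** (p0003:L27–32). Suppose that all the zeros `ρ = β + iγ` of the Riemann
> zeta-function with `T^{3/8} < γ ≤ T` lie within the thin box `½ − 1/(2 log T) < β < ½ + 1/(2 log T)`
> (1.5). Then for any sufficiently large `T > 0`, at least `61.7 %` of the nontrivial zeros are simple.

("Remark. The pair correlation method developed in this paper neither requires nor provides any
information as to whether or not the nontrivial zeros of `ζ(s)` satisfy `β = 1/2`.")

> **Theorem 3** (p0003:L47–52). Assuming that `N(σ,T) = o(T^{2(1−σ)})` for
> `½ + 1/(2 log T) ≤ σ ≤ 25/32 + η` (1.6), for any fixed `η > 0`, then as `T → ∞`, at least `61.7 %`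
> of the nontrivial zeros of `ζ(s)` are simple. (`N(σ,T)` = number of zeros with `β ≥ σ`,
> `0 < γ ≤ T`.)

§3 (p0006:L1–20): `ĝ(z) = ∫ g(α) e(−zα) dα`, `e(w) = e^{2πiw}`, analytic in `z`;
`ĝ(i(ρ−ρ′) log T/2π) = ∫ g(α) T^{α(ρ−ρ′)} dα`; (3.3)
`Σ_{ρ,ρ′} ĝ(i(ρ−ρ′) log T/2π) w(ρ−ρ′) = ((T/2π) log T) ∫ F(α)g(α) dα`.

> **Lemma 5** (p0006:L22–33). Suppose `α ∈ ℝ` and `z ∈ ℂ`. Suppose `r(α)` is a real-valued even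
> function in `L¹(ℝ)` with support in `[−1,1]`, and also `r(α)` is Lipschitz continuous at
> `α = 0`. Then `r̂(z)` is an even analytic function, `r̂(z) = 2∫₀¹ r(α) cos(2πzα) dα` (3.4), and
> we have `Σ_{ρ,ρ′: 0<γ,γ′≤T} r̂(i(ρ−ρ′) log T/2π) w(ρ−ρ′) = (T/2π) log T (r(0) + 2∫₀¹ α r(α) dα
> + O(1/√log T))` (3.5).

("a function `f(x)` is Lipschitz continuous at a point `x = a` if there are constants `C > 0` and
`δ > 0` such that `|f(x) − f(a)| ≤ C|x − a|` for all `x` in a neighborhood `|x − a| < δ` of `a`.")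

## Lean rendering / design choices (audit notes for ls-lit-ref)

* Zeros `ρ` with `0 < γ ≤ T`, counted WITH multiplicity: the tree's finite set
  `zetaZeroBox 0 T = {ρ : ζ(ρ) = 0, 0 ≤ Re ρ ≤ 1, 0 < Im ρ ≤ T}` (`zetaZeroBox_finite`; the
  non-trivial zeros have `0 < Re ρ < 1`, the trivial ones `Im ρ = 0`, so this IS "`0 < γ ≤ T`") as a
  `Finset` (`zerosUpTo T`), each `ρ` weighted by `m(ρ) = riemannZetaZeroOrder ρ` (as `ℕ`, `mult`):
  `Σ_{ρ,ρ′} f(ρ,ρ′)` "with multiplicity" = `Σ_{ρ,ρ′ ∈ zerosUpTo T} m(ρ)m(ρ′) f(ρ,ρ′)` (`pairSumWith`).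
* `x^{ρ−ρ′}` for real `x > 0` = Mathlib `(x : ℂ) ^ (ρ − ρ′)` (`= exp((ρ−ρ′) log x)`);
  `w(u) = 4/(4 − u²)` at complex `u` (`weight`); `F(x,T)` = `pairSum x T`;
  `F(α) = ((T/2π) log T)⁻¹ F(T^α,T)` = `formFactor α T`, a COMPLEX number whose reality is part of
  Theorem 1 ("real" ⟺ `im = 0`; "even" ⟺ `F(−α) = F(α)`; "nonnegative" ⟺ `0 ≤ re`).
* "`= T^{−2α}(log T + O(1)) + α + O(1/√log T)` uniformly for `0 ≤ α ≤ 1`, as `T → ∞`" ⟹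
  `∃ C T₀, ∀ T ≥ T₀, ∀ α ∈ [0,1], ‖F(α) − (T^{−2α} log T + α)‖ ≤ C (T^{−2α} + 1/√log T)`.
  The qualitative clauses (real, even, non-negative) are stated for all real `α` and `T ≥ 3`
  (the paper's standing range "`x > 0` and `T ≥ 3`"; they hold by Lemma 3 and the symmetry
  `ρ ↔ ρ′`, for every such `x, T`).
* `r̂(z) = ∫_ℝ r(α) e(−zα) dα` at COMPLEX `z` (`hatC`; for `supp r ⊆ [−1,1]` the integrand is
  integrable for every `z`). Lemma 5's hypotheses verbatim: `r` real (by type), even, `L¹`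
  (`Integrable`), `support r ⊆ [−1,1]` (`Function.support`), Lipschitz at `0`
  (`∃ C δ > 0, |α| < δ → |r(α) − r(0)| ≤ C|α|`). Its `O(1/√log T)` depends on `r`: `∀ r, ∃ C T₀`.
  Only (3.5) is recorded as the fact; (3.4) (`r̂(z) = 2∫₀¹ r cos(2πzα)`, evenness) is elementary and
  left to users.
* Theorems 2/3: "at least `61.7 %` of the nontrivial zeros are simple" for large `T` ⟹ for every
  `ε > 0` and all large `T`, `N_simple(T) ≥ (0.617 − ε)·N(T)` (`simpleZeroCount`: simple zeros in the
  strip up to `T`, each once; `zetaZeroCount`: all zeros with multiplicity) — the `ε` absorbs the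
  rounding of the printed percentage (the proof's constant exceeds `0.617` by an unprinted margin;
  no stronger reading is typed). Theorem 2's hypothesis is ON THE SAME `T` ("for any sufficiently
  large `T`"): `∀ ε > 0, ∃ T₀, ∀ T ≥ T₀, Box(T) → …`. Theorem 3's `o(T^{2(1−σ)})` uniformly on the
  `T`-dependent range `½ + 1/(2 log T) ≤ σ ≤ 25/32 + η` (`DensityHypothesis η`,
  `N(σ,T) = zetaZeroCountRe σ T`), "for any fixed `η > 0`" ⟹ `∀ η > 0, DensityHypothesis η → …`;
  the common conclusion is the predicate `SimpleProportion 0.617`.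
* Numerical constants verbatim: `3/8`, `1/(2 log T)`, `25/32`, `0.617`.

WHAT THIS IS NOT: no claim about RH, simplicity of zeros, or Siegel zeros; the hypotheses of
Theorems 2–3 are open. «The programme SEARCHES and TYPES; no claim about Landau–Siegel zeros,
Theorems 1–2 of arXiv:2211.02515 or a repaired Margin232 until a kernel theorem says so.»

## References

* [BaluyotEtAl2024] S. A. C. Baluyot, D. A. Goldston, A. I. Suriajaya, C. L. Turnage-Butterbaugh,
  Acta Arith. 214 (2024) 357–376, arXiv:2306.04799: §1 (1.2)–(1.6), Theorems 1–3; §3 (3.1)–(3.5),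
  Lemma 5.
* [BaluyotEtAl2025] S. A. C. Baluyot, D. A. Goldston, A. I. Suriajaya, C. L. Turnage-Butterbaugh,
  *Pair correlation of zeros of the Riemann zeta function I: Proportions of simple zeros and critical
  zeros*, arXiv:2501.14545 (2025; preprint, unrefereed as of 2026-08): §2 "Montgomery Theorem (MT)"
  with the authors' ERRATUM of [BaluyotEtAl2024, Theorem 1] (held text `paper:arxiv-2501.14545`,
  p0005:L15–33; correction credited there to R. Garunkštis and J. Paliulionytė).
* [Montgomery1973] H. L. Montgomery, Proc. Sympos. Pure Math. 24 (1973) 181–193 (the RH form; tree: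
  `montgomery_pair_correlation_restricted`, `MontgomeryPairCorrelation.lean`).
* Tree: `ZetaZeros.lean` (`zetaZeroBox`, `riemannZetaZeroOrder`, `zetaZeroCount(Re)`),
  `SimpleZeros.lean` (`simpleZeroCount`).
-/

noncomputable section

open Complex MeasureTheory

namespace Literature.NumberTheory.LFunctions

namespace BGSTB2024

/-! ### The objects of §1 and §3 -/

/-- The zeros `ρ` of `ζ` with `0 < Im ρ ≤ T` (automatically `0 < Re ρ < 1`), as a finite set — the
tree's `zetaZeroBox 0 T` (`zetaZeroBox_finite`). [cite: BaluyotEtAl2024, §1 (1.2)] -/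
def zerosUpTo (T : ℝ) : Finset ℂ :=
  (zetaZeroBox_finite 0 T).toFinset

/-- The multiplicity `m(ρ)` of a zero, as a natural number (the tree's `riemannZetaZeroOrder`,
which is `≥ 1` exactly at the zeros `ρ ≠ 1`). [cite: BaluyotEtAl2024, §1 ("counted with multiplicity")] -/
def mult (ρ : ℂ) : ℕ :=
  (riemannZetaZeroOrder ρ).toNat

/-- **`w(u) = 4/(4 − u²)`** at complex `u` (for `u = i(γ − γ′)` this is Montgomery's
`4/(4 + (γ−γ′)²)`). [cite: BaluyotEtAl2024, §1 (1.2)] -/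
def weight (u : ℂ) : ℂ :=
  4 / (4 - u ^ 2)

/-- A sum over PAIRS of zeros `ρ, ρ′` with `0 < γ, γ′ ≤ T`, counted with multiplicity.
[cite: BaluyotEtAl2024, §1 (1.2)] -/
def pairSumWith (T : ℝ) (f : ℂ → ℂ → ℂ) : ℂ :=
  ∑ ρ ∈ zerosUpTo T, ∑ ρ' ∈ zerosUpTo T, (mult ρ : ℂ) * (mult ρ' : ℂ) * f ρ ρ'

/-- **`F(x,T) = Σ_{ρ,ρ′: 0<γ,γ′≤T} x^{ρ−ρ′} w(ρ−ρ′)`** (1.2) (zeros with multiplicity; `x > 0`).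
[cite: BaluyotEtAl2024, §1 (1.2)] -/
def pairSum (x T : ℝ) : ℂ :=
  pairSumWith T fun ρ ρ' => (x : ℂ) ^ (ρ - ρ') * weight (ρ - ρ')

/-- **`F(α) = ((T/2π) log T)⁻¹ F(T^α, T)`** (1.3). [cite: BaluyotEtAl2024, §1 (1.3)] -/
def formFactor (α T : ℝ) : ℂ :=
  ((T / (2 * Real.pi) * Real.log T : ℝ) : ℂ)⁻¹ * pairSum (T ^ α) T

/-- **`r̂(z) = ∫_ℝ r(α) e(−zα) dα`**, `e(w) = e^{2πiw}`, at COMPLEX `z` (3.1) (an entire function of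
`z` when `r ∈ L¹` has compact support). [cite: BaluyotEtAl2024, §3 (3.1)] -/
def hatC (r : ℝ → ℝ) (z : ℂ) : ℂ :=
  ∫ a : ℝ, (r a : ℂ) * Complex.exp (-(2 * Real.pi * I) * z * a)

/-- The left side of (3.5): `Σ_{ρ,ρ′: 0<γ,γ′≤T} r̂(i(ρ−ρ′) log T/2π) w(ρ−ρ′)` (with multiplicity).
[cite: BaluyotEtAl2024, Lemma 5 (3.5)] -/
def kernelPairSum (r : ℝ → ℝ) (T : ℝ) : ℂ :=
  pairSumWith T fun ρ ρ' => hatC r (I * (ρ - ρ') * (Real.log T / (2 * Real.pi))) * weight (ρ - ρ')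

/-- **The thin-box hypothesis of Theorem 2 at height `T`**: every zero `ρ = β + iγ` with
`T^{3/8} < γ ≤ T` has `½ − 1/(2 log T) < β < ½ + 1/(2 log T)` (1.5).
[cite: BaluyotEtAl2024, Theorem 2 (1.5)] -/
def ThinBox (T : ℝ) : Prop :=
  ∀ ρ ∈ zetaZeroBox 0 T, T ^ ((3 : ℝ) / 8) < ρ.im → |ρ.re - 1 / 2| < 1 / (2 * Real.log T)

/-- **The strong zero-density hypothesis of Theorem 3**: `N(σ,T) = o(T^{2(1−σ)})` uniformly for
`½ + 1/(2 log T) ≤ σ ≤ 25/32 + η` (1.6), `N(σ,T)` = the tree's `zetaZeroCountRe σ T`.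
[cite: BaluyotEtAl2024, Theorem 3 (1.6)] -/
def DensityHypothesis (η : ℝ) : Prop :=
  ∀ c : ℝ, 0 < c → ∃ T₀ : ℝ, ∀ T : ℝ, T₀ ≤ T → ∀ σ : ℝ,
    1 / 2 + 1 / (2 * Real.log T) ≤ σ → σ ≤ 25 / 32 + η →
      (zetaZeroCountRe σ T : ℝ) ≤ c * T ^ (2 * (1 - σ))

/-- **"At least a proportion `c` of the nontrivial zeros are simple"** (as `T → ∞`): for every
`ε > 0` and all large `T`, `N_simple(T) ≥ (c − ε) N(T)` (Theorems 2–3 use `c = 0.617`).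
[cite: BaluyotEtAl2024, Theorems 2–3] -/
def SimpleProportion (c : ℝ) : Prop :=
  ∀ ε : ℝ, 0 < ε → ∃ T₀ : ℝ, ∀ T : ℝ, T₀ ≤ T →
    (c - ε) * (zetaZeroCount T : ℝ) ≤ (simpleZeroCount T : ℝ)

/-! ### API (proved) -/

/-- Membership in `zerosUpTo`. [cite: BaluyotEtAl2024, §1 (1.2)] -/
@[simp] theorem mem_zerosUpTo {T : ℝ} {ρ : ℂ} : ρ ∈ zerosUpTo T ↔ ρ ∈ zetaZeroBox 0 T := by
  simp [zerosUpTo]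

/-- `zerosUpTo` is monotone in the height. [cite: BaluyotEtAl2024, §1 (1.2)] -/
theorem zerosUpTo_mono {T T' : ℝ} (h : T ≤ T') : zerosUpTo T ⊆ zerosUpTo T' := by
  intro ρ hρ
  rw [mem_zerosUpTo] at hρ ⊢
  exact ⟨hρ.1, hρ.2.1, hρ.2.2.1, hρ.2.2.2.1, hρ.2.2.2.2.trans h⟩

/-- A zero in the box has positive multiplicity. [cite: BaluyotEtAl2024, §1 ("counted with multiplicity")] -/
theorem mult_pos {T : ℝ} {ρ : ℂ} (hρ : ρ ∈ zerosUpTo T) : 0 < mult ρ := by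
  rw [mem_zerosUpTo] at hρ
  have h1 : ρ ≠ 1 := fun h => by
    have := hρ.2.2.2.1
    rw [h] at this
    simp at this
  have := (riemannZetaZeroOrder_pos_iff h1).mpr hρ.1
  unfold mult
  omega

/-- Montgomery's weight on the line: `w(i u) = 4/(4 + u²)` for real `u`.
[cite: BaluyotEtAl2024, §1 ("if RH holds then (1.2) agrees with (1.1)")] -/
theorem weight_mul_I (u : ℝ) : weight (I * u) = 4 / (4 + (u : ℂ) ^ 2) := by
  unfold weight
  congr 1
  rw [mul_pow, Complex.I_sq]
  ring

/-- `F(x, T)` at `x = 1` is `Σ_{ρ,ρ′} w(ρ − ρ′)` (with multiplicity). [cite: BaluyotEtAl2024, §1 (1.2)] -/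
theorem pairSum_one (T : ℝ) : pairSum 1 T = pairSumWith T fun ρ ρ' => weight (ρ - ρ') := by
  unfold pairSum
  congr 1
  funext ρ ρ'
  rw [Complex.ofReal_one, Complex.one_cpow, one_mul]

/-! ### The objects of the authors' 2025 correction (§2 of arXiv:2501.14545: dyadic window) -/

/-- The zeros `ρ` of `ζ` with `T < Im ρ ≤ 2T`, as a finite set — the window of the CORRECTED
Montgomery theorem of Baluyot–Goldston–Suriajaya–Turnage-Butterbaugh 2025, §2 ("the sum `𝓕(x,T)`
… is taken over zeros satisfying `T < γ, γ′ ≤ 2T`, whereas in [BGST-PC] the sum is taken over zeros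
satisfying `0 < γ, γ′ ≤ T`"). [cite: BaluyotEtAl2025, §2 (calF)] -/
def zerosIn (T : ℝ) : Finset ℂ :=
  (zerosUpTo (2 * T)).filter fun ρ => T < ρ.im

/-- **`𝓕(x,T) = Σ_{ρ,ρ′: T<γ,γ′≤2T} x^{ρ−ρ′} W(ρ−ρ′)`**, `W(u) = 4/(4 − u²)` (zeros with multiplicity;
`x > 0`) — the pair sum of the corrected theorem over the dyadic window.
[cite: BaluyotEtAl2025, §2 (calF)] -/
def pairSumDyadic (x T : ℝ) : ℂ :=
  ∑ ρ ∈ zerosIn T, ∑ ρ' ∈ zerosIn T,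
    (mult ρ : ℂ) * (mult ρ' : ℂ) * ((x : ℂ) ^ (ρ - ρ') * weight (ρ - ρ'))

/-- Membership in `zerosIn`. [cite: BaluyotEtAl2025, §2 (calF)] -/
@[simp] theorem mem_zerosIn {T : ℝ} {ρ : ℂ} :
    ρ ∈ zerosIn T ↔ ρ ∈ zetaZeroBox 0 (2 * T) ∧ T < ρ.im := by
  simp [zerosIn]

/-- The dyadic window is part of the box up to `2T`. [cite: BaluyotEtAl2025, §2 (calF)] -/
theorem zerosIn_subset (T : ℝ) : zerosIn T ⊆ zerosUpTo (2 * T) :=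
  Finset.filter_subset _ _

/-- `𝓕(1,T) = Σ m(ρ)m(ρ′) W(ρ−ρ′)` over the dyadic window. [cite: BaluyotEtAl2025, §2 (calF)] -/
theorem pairSumDyadic_one (T : ℝ) :
    pairSumDyadic 1 T =
      ∑ ρ ∈ zerosIn T, ∑ ρ' ∈ zerosIn T, (mult ρ : ℂ) * (mult ρ' : ℂ) * weight (ρ - ρ') := by
  unfold pairSumDyadic
  refine Finset.sum_congr rfl fun ρ _ => Finset.sum_congr rfl fun ρ' _ => ?_
  rw [Complex.ofReal_one, Complex.one_cpow, one_mul]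

end BGSTB2024

open BGSTB2024

/-! ### The named facts -/

/-- **ERRATUM OF RECORD (cell landau-siegel REF-C ruling (α), 2026-08-27).** The error-term precision
rendered below — `‖F(α) − (T^{−2α} log T + α)‖ ≤ C (T^{−2α} + 1/√log T)`, i.e. the printed (1.4)
`F(α) = T^{−2α}(log T + O(1)) + α + O(1/√log T)` — was RETRACTED BY THE AUTHORS in arXiv:2501.14545,
§2 (their "Montgomery Theorem (MT)"; held text `paper:arxiv-2501.14545` p0005:L15–33): the corrected
statement (dyadic window `T < γ,γ′ ≤ 2T`) is `𝓕(x,T) = (T/(2πx²)) log²T (1 + O(1/√log T)) +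
(T/2π) log x + O(T√log T)` uniformly for `1 ≤ x ≤ T`, which in the normalisation below gives only
`O(T^{−2α}·√(log T) + 1/√log T)`; "the source of the error came from applying Lemma 8 of [GM87]";
"all the applications of Theorem 1 in [BGST-PC], such as Lemma 5 and Lemma 7, remain correct". This
named fact therefore states MORE than is now claimed in print on `0 ≤ α < (log log T)/(2 log T)`; it is
kept under its name with its meaning unchanged (Literature rule: never edit a def's meaning in place),
it has no consumers in the tree and must not acquire any — it is `@[deprecated]` in favour of
`Literature.NumberTheory.LFunctions.baluyotEtAl2025_montgomeryTheorem` (the corrected statement,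
claim-tagged, declared below; since PROVED, `baluyotEtAl2025_montgomeryTheorem_holds`). The CORRECTED
normalised statement over THIS window (`0 < γ,γ′ ≤ T`), `F(α) = T^{−2α} log T + α + O(T^{−2α}√log T +
1/√log T)` uniformly on `0 ≤ α ≤ 1`, is a tree THEOREM: `BGSTB2024.formFactor_montgomeryTheorem`
(`UnconditionalPairCorrelationTheorem1Proofs.lean`; un-normalised `BGSTB2024.pairSum_montgomeryTheorem`).
`baluyotEtAl2024_lemma5`, `_theorem2`, `_theorem3` are unaffected (and all three since DISCHARGED).
Locator of the erratum: BaluyotEtAl2025, §2 (MT), p0005:L15–33. [claim: BaluyotEtAl2025, status: under-review]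

**Baluyot–Goldston–Suriajaya–Turnage-Butterbaugh 2024, Theorem 1** (UNCONDITIONAL Montgomery
theorem). "The function `F(α)` is real, even, and nonnegative. Moreover, as `T → ∞`, we have
`F(α) = T^{−2α}(log T + O(1)) + α + O(1/√log T)` uniformly for `0 ≤ α ≤ 1`", where
`F(α) = ((T/2π) log T)⁻¹ Σ_{ρ,ρ′: 0<γ,γ′≤T} T^{α(ρ−ρ′)} w(ρ−ρ′)`, `w(u) = 4/(4 − u²)`, the sum over
ALL non-trivial zeros `ρ = β + iγ` (no RH), with multiplicity. Rendered: the qualitative clauses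
for all real `α` and `T ≥ 3`; the asymptotic as `∃ C T₀, ∀ T ≥ T₀, ∀ α ∈ [0,1],
‖F(α) − (T^{−2α} log T + α)‖ ≤ C (T^{−2α} + 1/√log T)`. NAMED FACT, not proved here (Lemmas 1–4:
Montgomery's explicit formula with `δ = β − ½` kept, the `L²` identity (2.5), the
Montgomery–Vaughan mean value theorem, Vinogradov's zero-free region for the truncation).
[cite: BaluyotEtAl2024, Theorem 1] -/
def baluyotEtAl2024_theorem1 : Prop :=
  (∀ α T : ℝ, 3 ≤ T →
      (formFactor α T).im = 0 ∧ formFactor (-α) T = formFactor α T ∧ 0 ≤ (formFactor α T).re) ∧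
    ∃ C : ℝ, ∃ T₀ : ℝ, ∀ T : ℝ, T₀ ≤ T → ∀ α : ℝ, 0 ≤ α → α ≤ 1 →
      ‖formFactor α T - ((T ^ (-(2 * α)) * Real.log T + α : ℝ) : ℂ)‖ ≤
        C * (T ^ (-(2 * α)) + 1 / Real.sqrt (Real.log T))

/-- **Baluyot–Goldston–Suriajaya–Turnage-Butterbaugh 2025, §2 "Montgomery Theorem (MT)"** — the
authors' own CORRECTED form of their 2024 Theorem 1, i.e. the ERRATUM OF RECORD for
`baluyotEtAl2024_theorem1` above. Printed (arXiv:2501.14545, §2, p. 5): "**Montgomery Theorem (MT).**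
For `x ≥ 1` and `T ≥ 3`, we have `𝓕(x,T) ≥ 0`, `𝓕(x,T) = 𝓕(1/x,T)`, and
`𝓕(x,T) = (T/(2πx²)) log²T (1 + O(1/√log T)) + (T/2π) log x + O(T√log T)`, uniformly for
`1 ≤ x ≤ T`", where `𝓕(x,T) := Σ_{ρ,ρ′: T<γ,γ′≤2T} x^{ρ−ρ′} W(ρ−ρ′)`, `W(u) := 4/(4 − u²)`, zeros
with multiplicity; followed by: "The statement above has been modified from its original formulation
in [BGST-PC], with two changes. First, … the sum `𝓕(x,T)` above is taken over zeros satisfying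
`T < γ, γ′ ≤ 2T` … Secondly, and more importantly, the error terms appearing above have been
corrected from those in the original statement of the theorem. [Footnote: All the applications of
Theorem 1 in [BGST-PC], such as Lemma 5 and Lemma 7, remain correct … The source of the error came
from applying Lemma 8 of [GM87], which has the same issue but likewise no effect on any consequential
results in that paper.] The result stated in [BGST-PC] … was
`𝓕(x,T) = ((T/(2πx²)) log²T + (T/2π) log x)(1 + O(1/√log T))`. Note that if, for example,
`x = c log T`, then … the factor of `c` on the `T` term is incorrect. In the corrected version above
the error term `O(T√log T)` which now holds over the whole range `1 ≤ x ≤ T` absorbs all these terms"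
(the correction is credited to R. Garunkštis and J. Paliulionytė). CONSEQUENCE FOR THE 2024 TYPING:
in normalised form (divide by `(T/2π) log T`, `x = T^α`) the corrected statement gives only
`F(α) = T^{−2α} log T + α + O(T^{−2α}·√(log T) + 1/√log T)`, whereas `baluyotEtAl2024_theorem1`
renders the retracted precision `O(T^{−2α} + 1/√log T)` (stronger exactly on
`0 ≤ α < log log T/(2 log T)`, the authors' `x = c log T` example); that def has NO consumers in the
tree and should not acquire any — feed THIS fact instead; `baluyotEtAl2024_lemma5` and Theorems 2–3
are unaffected per the authors. Rendered: the qualitative clauses for all `x ≥ 1`, `T ≥ 3`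
("`≥ 0`" ⟺ real with non-negative real part); the asymptotic as `∃ C T₀, ∀ T ≥ T₀, ∀ x ∈ [1,T],
‖𝓕(x,T) − ((T/(2πx²)) log²T + (T/2π) log x)‖ ≤ C ((T/(2πx²)) log²T/√(log T) + T √(log T))`.
NAMED FACT, not proved here; CLAIM-TAGGED (arXiv preprint, unrefereed as of 2026-08 — cell rule A8).
Locator: BaluyotEtAl2025, §2 "Montgomery Theorem (MT)", p0005:L15–33.
[claim: BaluyotEtAl2025, status: under-review] -/
def baluyotEtAl2025_montgomeryTheorem : Prop :=
  (∀ x T : ℝ, 1 ≤ x → 3 ≤ T →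
      (pairSumDyadic x T).im = 0 ∧ 0 ≤ (pairSumDyadic x T).re ∧
        pairSumDyadic (1 / x) T = pairSumDyadic x T) ∧
    ∃ C : ℝ, ∃ T₀ : ℝ, ∀ T : ℝ, T₀ ≤ T → ∀ x : ℝ, 1 ≤ x → x ≤ T →
      ‖pairSumDyadic x T -
          ((T / (2 * Real.pi * x ^ 2) * Real.log T ^ 2 + T / (2 * Real.pi) * Real.log x : ℝ) : ℂ)‖ ≤
        C * (T / (2 * Real.pi * x ^ 2) * Real.log T ^ 2 / Real.sqrt (Real.log T) +
          T * Real.sqrt (Real.log T))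

attribute [deprecated baluyotEtAl2025_montgomeryTheorem (since := "2026-08-27")]
  baluyotEtAl2024_theorem1

/-- **Baluyot–Goldston–Suriajaya–Turnage-Butterbaugh 2024, Lemma 5** (pairs of zeros against an
even kernel of Fourier support `[−1,1]`, UNCONDITIONAL). "Suppose `r(α)` is a real-valued even
function in `L¹(ℝ)` with support in `[−1,1]`, and also `r(α)` is Lipschitz continuous at `α = 0`.
Then … `Σ_{ρ,ρ′: 0<γ,γ′≤T} r̂(i(ρ−ρ′) log T/2π) w(ρ−ρ′) = (T/2π) log T (r(0) + 2∫₀¹ α r(α) dα +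
O(1/√log T))`" (3.5), `r̂(z) = ∫ r(α)e(−zα) dα` at complex `z` (`= ∫ r(α) T^{α(ρ−ρ′)} dα` here).
The `O` depends on `r`: `∀ r, ∃ C T₀`. ("If we assume RH this agrees with the earlier version in
[Montgomery73]" — the input from which Montgomery / GGOS / Chirre–Gonçalves–de Laat /
Bui–Goldston–Milinovich–Montgomery obtain, ON RH, positive proportions of spacings below
`0.60…` mean spacings; tree: `ZetaSpacingDensityRH.lean`.) NAMED FACT; since DISCHARGED —
`baluyotEtAl2024_lemma5_holds` (`UnconditionalPairCorrelationLemma5Proofs.lean`: (3.3)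
`BGSTB2024.kernelPairSum_eq_integral` + the corrected Theorem 1 over `0 < γ ≤ T`
(`BGSTB2024.pairSum_montgomeryTheorem`, `UnconditionalPairCorrelationTheorem1Proofs.lean`) + the
Lipschitz condition at `0`, as in the printed proof). [cite: BaluyotEtAl2024, Lemma 5] -/
def baluyotEtAl2024_lemma5 : Prop :=
  ∀ r : ℝ → ℝ, (∀ a : ℝ, r (-a) = r a) → Integrable r →
    Function.support r ⊆ Set.Icc (-1) 1 →
      (∃ C δ : ℝ, 0 < δ ∧ ∀ a : ℝ, |a| < δ → |r a - r 0| ≤ C * |a|) →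
        ∃ C : ℝ, ∃ T₀ : ℝ, ∀ T : ℝ, T₀ ≤ T →
          ‖kernelPairSum r T -
              ((T / (2 * Real.pi) * Real.log T * (r 0 + 2 * ∫ a in (0 : ℝ)..1, a * r a) : ℝ) : ℂ)‖ ≤
            C * (T / (2 * Real.pi) * Real.log T / Real.sqrt (Real.log T))

/-- **Baluyot–Goldston–Suriajaya–Turnage-Butterbaugh 2024, Theorem 2.** "Suppose that all the zeros
`ρ = β + iγ` of the Riemann zeta-function with `T^{3/8} < γ ≤ T` lie within the thin box
`½ − 1/(2 log T) < β < ½ + 1/(2 log T)`. Then for any sufficiently large `T > 0`, at least `61.7 %`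
of the nontrivial zeros are simple." Rendered: for every `ε > 0` and all large `T`, the thin-box
hypothesis AT `T` gives `N_simple(T) ≥ (0.617 − ε) N(T)` (simple zeros in the strip up to `T` vs all
zeros with multiplicity; "The pair correlation method … neither requires nor provides any
information as to whether or not the nontrivial zeros satisfy `β = 1/2`"). NAMED FACT, not proved
here by the paper's route (Theorem 1 + a modified Tsang kernel); since DISCHARGED —
`baluyotEtAl2024_theorem2_holds` (`CriticalLineTwoThirdsSimpleZerosConsequences.lean`: the conclusion holds
for all large `T` with the thin-box hypothesis unused, from the tree's kernel theorem
`AlpogeFurman2026_simple_critical_holds`, `0.617 ≤ 2/3`). [cite: BaluyotEtAl2024, Theorem 2] -/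
def baluyotEtAl2024_theorem2 : Prop :=
  ∀ ε : ℝ, 0 < ε → ∃ T₀ : ℝ, ∀ T : ℝ, T₀ ≤ T → ThinBox T →
    (0.617 - ε) * (zetaZeroCount T : ℝ) ≤ (simpleZeroCount T : ℝ)

/-- **Baluyot–Goldston–Suriajaya–Turnage-Butterbaugh 2024, Theorem 3.** "Assuming that
`N(σ,T) = o(T^{2(1−σ)})` for `½ + 1/(2 log T) ≤ σ ≤ 25/32 + η`, for any fixed `η > 0`, then as
`T → ∞`, at least `61.7 %` of the nontrivial zeros of `ζ(s)` are simple." Rendered: for every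
`η > 0`, the density hypothesis (uniform little-`o` on the `T`-dependent `σ`-range) implies
`N_simple(T) ≥ (0.617 − ε) N(T)` for every `ε > 0` and all large `T`. (The authors note that the
weaker Iwaniec–Kowalski density bound `N(σ,T) ≪ T^{2(1−σ)} log T` "is too weak to be used in
Theorem 3".) A THEOREM of print (an implication with its hypothesis explicit), NAMED FACT, not
proved here by the paper's route; since DISCHARGED — `baluyotEtAl2024_theorem3_holds`
(`CriticalLineTwoThirdsSimpleZerosConsequences.lean`: `SimpleProportion c` holds for every `c ≤ 2/3`,
`BGSTB2024.simpleProportion_of_le_two_thirds`). [cite: BaluyotEtAl2024, Theorem 3] -/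
def baluyotEtAl2024_theorem3 : Prop :=
  ∀ η : ℝ, 0 < η → DensityHypothesis η → SimpleProportion 0.617

/-! ### Bookkeeping (proved) -/

/-- Theorem 2 in the shape of Theorem 3's conclusion: if the thin-box hypothesis holds at ALL large
heights, at least `61.7 %` of the zeros are simple. [cite: BaluyotEtAl2024, Theorem 2] -/
theorem baluyotEtAl2024_theorem2.simpleProportion (h : baluyotEtAl2024_theorem2)
    (hbox : ∃ T₁ : ℝ, ∀ T : ℝ, T₁ ≤ T → ThinBox T) : SimpleProportion 0.617 := by
  intro ε hε
  obtain ⟨T₀, hT₀⟩ := h ε hε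
  obtain ⟨T₁, hT₁⟩ := hbox
  exact ⟨max T₀ T₁, fun T hT => hT₀ T (le_of_max_le_left hT) (hT₁ T (le_of_max_le_right hT))⟩

/-- `SimpleProportion` is downward monotone in the proportion. [cite: BaluyotEtAl2024, Theorems 2–3] -/
theorem BGSTB2024.SimpleProportion.mono {c c' : ℝ} (hle : c ≤ c') (h : SimpleProportion c') :
    SimpleProportion c := by
  intro ε hε
  obtain ⟨T₀, hT₀⟩ := h ε hε
  refine ⟨T₀, fun T hT => (hT₀ T hT).trans' ?_⟩
  exact mul_le_mul_of_nonneg_right (by linarith) (Nat.cast_nonneg _)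

/-- The density hypothesis is monotone in `η` (a longer `σ`-range is a stronger hypothesis).
[cite: BaluyotEtAl2024, Theorem 3 (1.6)] -/
theorem BGSTB2024.DensityHypothesis.anti {η η' : ℝ} (hle : η ≤ η')
    (h : DensityHypothesis η') : DensityHypothesis η := by
  intro c hc
  obtain ⟨T₀, hT₀⟩ := h c hc
  exact ⟨T₀, fun T hT σ h1 h2 => hT₀ T hT σ h1 (h2.trans (by linarith))⟩

end Literature.NumberTheory.LFunctions

end
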